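import Summits.HodgeConjecture.CorCM.Census.OcticDecicWeil
import Summits.HodgeConjecture.CorCM.Census.SexticDecicWeilDefect
import Mathlib.Algebra.Group.Fin.Basic
import Mathlib.Logic.Equiv.Fin.Rotate
import Mathlib.Tactic.Abel
import HarnessLib

/-!
# `E × B₄ × B₅` over an octic and a decic CM field sharing `k`: THE DEFECT LAW from a realised ROTATION of the five decic pairs and
# transitivity on the four octic pairs — `d₂ ≡ t₂`, `d₃ ≡ t₃`, `e = 2t₂ + t₃`

COR-CM (cell `pub-hodgecm2`), seat b30 gen 27 (2026-08-23); count-neutral own lane OCTIC-DECIC, sequel of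
`Census/OcticDecicWeil.lean` (model `PtOD`, `phiOD`, `ModelBalancedOD`, the signed form).  Theorems of the finite model only; no
definition, no named fact, no geometry, no `sorry`, no `decide`.

THE ARGUMENT.  Unknowns: the curve defect `e = N(τ) − N(τ̄)`, the fourfold defects `d₂(a)` (`a < 4`), the fivefold defects `d₃(b)`
(`b < 5`).  The signed equation at a realised pair `π = (π₂, π₃)` reads `e + (2 d₂(π₂⁻¹ 0) − Σ d₂) + (2 (d₃(π₃⁻¹ 0) + d₃(π₃⁻¹ 1)) − Σ d₃) = 0`
(`sum_ite_perm_eq`, `sum_ite_pair_eq`).  HYPOTHESES ON `R` (both automatic downstream for the realised pairs of an octic and a decic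
CM field through `k`, with NO Galois hypothesis): (i) `R` is stable under right translation of the decic component by a ROTATION
`ρ = g ∘ (+1) ∘ g⁻¹` of the five pairs (`hrot`; downstream: a realised `5`-cycle exists by Cauchy's theorem in the transitive group of
realised permutations, gen 23ʼs `DecicWeil23Pair.exists_orderFive_mem_realisedPerms`, and `(π₂, σ)¹² = (1, σ²)`); (ii) every octic
pair is moved to the pair `0` by some member (`ht`; downstream: `Aut(ℂ)` is transitive on the embeddings of `K₂`).  From (i), the five
equations at `(π₂, π₃ ρʲ)` have the same `e`- and `d₂`-parts, so in the frame `u = d₃ ∘ g`, `π' = π₃ g` the pair sums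
`u(p − j) + u(q − j)` (`π' p = 0`, `π' q = 1`) are constant in `j`; on `ℤ/5` this forces `u` constant (`const_of_pairSums`: two steps of
size `q − p ≠ 0` generate), i.e. `d₃ ≡ t₃`, whence the decic part of EVERY equation is `4t₃ − 5t₃ = −t₃`; from (ii) then `d₂ ≡ t₂`
and `e = 4t₂ − 2t₂ + t₃ = 2t₂ + t₃`: **`defectOD_of_signed`**.  Conversely the defect law gives the signed equation at EVERY pair of
permutations (`signedOD_of_defectOD`).  On configurations: **`exists_defectOD_of_modelBalancedOD`**, `balancedOD_of_defect`,
`ModelBalancedOD.of_rot`.  (Exact python `work/scratch/census810.py`: nullity `12 = 10 + 2` under every `C₄ × C₅`.)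
[cite: Pohlmann1968, Thm 1] [cite: GaoUllmo2025, Thm 3.1] [cite: MoonenZarhin1995Duke, Thm. 2.4] [cite: DixonMortimer1996, §2.1]

## References
* [Pohlmann1968] H. Pohlmann, Ann. of Math. 88 (1968), Thm 1.  [GaoUllmo2025] Z. Gao, E. Ullmo, J. Inst. Math. Jussieu 25 (2025),
  Thm 3.1.  [MoonenZarhin1995Duke] B. Moonen, Yu. Zarhin, Duke Math. J. 77 (1995), Thm. 2.4.  [DixonMortimer1996] J. D. Dixon,
  B. Mortimer, *Permutation Groups*, GTM 163, §2.1.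
-/

namespace Summit.HodgeConjecture.CorCM.Census.OcticDecicWeil

open Finset
open Summit.HodgeConjecture.CorCM.Census.SexticOcticWeil (sum_ite_perm_eq)
open Summit.HodgeConjecture.CorCM.Census.SexticDecicWeil (mul_conj_finRotate_pow_apply sum_ite_pair_eq const_of_pairSums sum_ite_rot_pow_eq)

/-! ### The defect law (the rotation lemmas `mul_conj_finRotate_pow_apply`, `sum_ite_pair_eq`, `const_of_pairSums`,
`sum_ite_rot_pow_eq` are those of `Census/SexticDecicWeilDefect`, used BY NAME) -/

section Defect

variable {R : Finset (Equiv.Perm (Fin 4) × Equiv.Perm (Fin 5))}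

/-- Rotation-stability iterates: `(π₁, π₃ ρⁿ) ∈ R` for all `n`. [folklore] -/
theorem mem_of_rot (g : Equiv.Perm (Fin 5)) (hrot : ∀ π ∈ R, (π.1, π.2 * (g * finRotate 5 * g⁻¹)) ∈ R)
    {π : Equiv.Perm (Fin 4) × Equiv.Perm (Fin 5)} (hπ : π ∈ R) (n : ℕ) : (π.1, π.2 * (g * finRotate 5 * g⁻¹) ^ n) ∈ R := by
  set ρ : Equiv.Perm (Fin 5) := g * finRotate 5 * g⁻¹
  induction n with
  | zero => rw [pow_zero, mul_one]; exact hπ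
  | succ n ih =>
    have h := hrot _ ih
    dsimp only at h
    rw [pow_succ, ← mul_assoc]
    exact h

/-- **THE DEFECT LAW (integer form).**  If `e`, `d₂`, `d₃` satisfy the signed equation at every pair of a set `R` that is stable under
right translation of the decic component by a conjugate rotation (`hrot`) and moves every octic pair to `0` (`ht`), then `d₂ ≡ t₂`,
`d₃ ≡ t₃` are constant and `e = 2t₂ + t₃`. [cite: MoonenZarhin1995Duke, Thm. 2.4] [cite: GaoUllmo2025, Thm 3.1] -/
theorem defectOD_of_signed (g : Equiv.Perm (Fin 5)) (hrot : ∀ π ∈ R, (π.1, π.2 * (g * finRotate 5 * g⁻¹)) ∈ R)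
    (ht : ∀ x : Fin 4, ∃ π ∈ R, π.1 x = 0) {e : ℤ} {d₂ : Fin 4 → ℤ} {d₃ : Fin 5 → ℤ}
    (h : ∀ π ∈ R, e + (∑ a : Fin 4, (if π.1 a = 0 then d₂ a else -d₂ a)) +
      (∑ b : Fin 5, (if (π.2 b = 0 ∨ π.2 b = 1) then d₃ b else -d₃ b)) = 0) :
    ∃ t₂ t₃ : ℤ, (∀ a, d₂ a = t₂) ∧ (∀ b, d₃ b = t₃) ∧ e = 2 * t₂ + t₃ := by
  -- a base pair, the frame `u = d₃ ∘ g`, the two positions `p, q` of `π' = π₃ g`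
  obtain ⟨π₀, hπ₀, -⟩ := ht 0
  set u : Fin 5 → ℤ := fun c => d₃ (g c) with hu
  have hp : (π₀.2 * g) ((π₀.2 * g).symm 0) = 0 := (π₀.2 * g).apply_symm_apply 0
  have hq : (π₀.2 * g) ((π₀.2 * g).symm 1) = 1 := (π₀.2 * g).apply_symm_apply 1
  have hpq : (π₀.2 * g).symm 0 ≠ (π₀.2 * g).symm 1 := fun hh => by
    have h' := congrArg (π₀.2 * g) hh
    rw [hp, hq] at h'
    exact absurd h' (by decide)
  -- the pair sums along the rotation are constant
  have hS : ∀ j : Fin 5, u ((π₀.2 * g).symm 0 - j) + u ((π₀.2 * g).symm 1 - j) = u ((π₀.2 * g).symm 0) + u ((π₀.2 * g).symm 1) := by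
    intro j
    have h0 := h _ (mem_of_rot g hrot hπ₀ ((0 : Fin 5) : ℕ))
    have hj := h _ (mem_of_rot g hrot hπ₀ (j : ℕ))
    dsimp only at h0 hj
    rw [sum_ite_rot_pow_eq π₀.2 g d₃ 0 hp hq, sub_zero, sub_zero] at h0
    rw [sum_ite_rot_pow_eq π₀.2 g d₃ j hp hq] at hj
    simp only [hu]
    linarith
  -- hence `d₃` is constant
  have huc : ∀ c, u c = u ((π₀.2 * g).symm 0) := const_of_pairSums hpq hS
  have hd₃ : ∀ b, d₃ b = d₃ (g ((π₀.2 * g).symm 0)) := fun b => by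
    have h' := huc (g.symm b)
    simp only [hu, Equiv.apply_symm_apply] at h'
    exact h'
  -- the decic part of every equation is `−t₃`
  have hB : ∀ π₃ : Equiv.Perm (Fin 5), (∑ b : Fin 5, (if (π₃ b = 0 ∨ π₃ b = 1) then d₃ b else -d₃ b)) =
      -d₃ (g ((π₀.2 * g).symm 0)) := by
    intro π₃
    rw [sum_ite_pair_eq π₃ (π₃.apply_symm_apply 0) (π₃.apply_symm_apply 1) d₃, Finset.sum_congr rfl fun b _ => hd₃ b,
      hd₃ (π₃.symm 0), hd₃ (π₃.symm 1), Finset.sum_const, Finset.card_univ, Fintype.card_fin]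
    ring
  -- the equation at a pair moving `x` to `0`
  have heq : ∀ x : Fin 4, e + (2 * d₂ x - ∑ a, d₂ a) - d₃ (g ((π₀.2 * g).symm 0)) = 0 := by
    intro x
    obtain ⟨π, hπ, hx⟩ := ht x
    have h1 := h π hπ
    rw [sum_ite_perm_eq π.1 hx d₂, hB π.2] at h1
    linarith
  refine ⟨d₂ 0, d₃ (g ((π₀.2 * g).symm 0)), fun a => ?_, hd₃, ?_⟩
  · have h1 := heq a; have h2 := heq 0; linarith
  · have h1 : ∀ a, d₂ a = d₂ 0 := fun a => by have h1 := heq a; have h2 := heq 0; linarith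
    have hs₁ : ∑ a, d₂ a = 4 * d₂ 0 := by
      rw [Finset.sum_congr rfl fun a _ => h1 a, Finset.sum_const, Finset.card_univ, Fintype.card_fin]; ring
    have h3 := heq 0
    rw [hs₁] at h3
    linarith

/-- **Conversely, the defect law gives the signed equation at EVERY pair of permutations** (`2t₂ − 4t₂ + 4t₃ − 5t₃ = −(2t₂ + t₃)`).
[folklore] -/
theorem signedOD_of_defectOD {e t₂ t₃ : ℤ} {d₂ : Fin 4 → ℤ} {d₃ : Fin 5 → ℤ} (h₁ : ∀ a, d₂ a = t₂) (h₃ : ∀ b, d₃ b = t₃)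
    (he : e = 2 * t₂ + t₃) (π : Equiv.Perm (Fin 4) × Equiv.Perm (Fin 5)) :
    e + (∑ a : Fin 4, (if π.1 a = 0 then d₂ a else -d₂ a)) + (∑ b : Fin 5, (if (π.2 b = 0 ∨ π.2 b = 1) then d₃ b else -d₃ b)) = 0 := by
  rw [sum_ite_perm_eq π.1 (π.1.apply_symm_apply 0) d₂, sum_ite_pair_eq π.2 (π.2.apply_symm_apply 0) (π.2.apply_symm_apply 1) d₃,
    Finset.sum_congr rfl fun a _ => h₁ a, Finset.sum_congr rfl fun b _ => h₃ b, h₁, h₃, h₃, he, Finset.sum_const, Finset.sum_const,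
    Finset.card_univ, Finset.card_univ, Fintype.card_fin, Fintype.card_fin]
  ring

end Defect

/-! ### The defect law for configurations -/

section Config

variable {α : Type*} {R : Finset (Equiv.Perm (Fin 4) × Equiv.Perm (Fin 5))} {v : α → PtOD}

/-- **THE DEFECT LAW FOR CONFIGURATIONS.**  For an `R`-balanced configuration, `R` rotation-stable on the decic pairs and transitive on
the octic pairs: the fourfold counts have ONE defect `t₂ = N(1,a,+) − N(1,a,−)` (all `a`), the fivefold counts ONE defect `t₃`, and the
curve defect is `N(τ) − N(τ̄) = 2t₂ + t₃`. [cite: MoonenZarhin1995Duke, Thm. 2.4] [cite: GaoUllmo2025, Thm 3.1] -/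
theorem exists_defectOD_of_modelBalancedOD (g : Equiv.Perm (Fin 5)) (hrot : ∀ π ∈ R, (π.1, π.2 * (g * finRotate 5 * g⁻¹)) ∈ R)
    (ht : ∀ x : Fin 4, ∃ π ∈ R, π.1 x = 0) {T : Finset α} (hT : ModelBalancedOD R v T) :
    ∃ t₂ t₃ : ℤ,
      (∀ a : Fin 4, ((T.filter fun x => v x = Sum.inr (Sum.inl (a, true))).card : ℤ) -
        (T.filter fun x => v x = Sum.inr (Sum.inl (a, false))).card = t₂) ∧
      (∀ b : Fin 5, ((T.filter fun x => v x = Sum.inr (Sum.inr (b, true))).card : ℤ) -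
        (T.filter fun x => v x = Sum.inr (Sum.inr (b, false))).card = t₃) ∧
      ((T.filter fun x => v x = Sum.inl true).card : ℤ) - (T.filter fun x => v x = Sum.inl false).card = 2 * t₂ + t₃ := by
  classical
  exact defectOD_of_signed g hrot ht
    (d₂ := fun a => ((T.filter fun x => v x = Sum.inr (Sum.inl (a, true))).card : ℤ) -
      (T.filter fun x => v x = Sum.inr (Sum.inl (a, false))).card)
    (d₃ := fun b => ((T.filter fun x => v x = Sum.inr (Sum.inr (b, true))).card : ℤ) -
      (T.filter fun x => v x = Sum.inr (Sum.inr (b, false))).card)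
    fun π hπ => signed_of_modelBalancedOD R v hT hπ

/-- **A configuration obeying the defect law is balanced at EVERY pair of permutations** (so under any `R`). [folklore] -/
theorem balancedOD_of_defect {T : Finset α} {t₂ t₃ : ℤ}
    (h₁ : ∀ a : Fin 4, ((T.filter fun x => v x = Sum.inr (Sum.inl (a, true))).card : ℤ) -
      (T.filter fun x => v x = Sum.inr (Sum.inl (a, false))).card = t₂)
    (h₃ : ∀ b : Fin 5, ((T.filter fun x => v x = Sum.inr (Sum.inr (b, true))).card : ℤ) -
      (T.filter fun x => v x = Sum.inr (Sum.inr (b, false))).card = t₃)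
    (he : ((T.filter fun x => v x = Sum.inl true).card : ℤ) - (T.filter fun x => v x = Sum.inl false).card = 2 * t₂ + t₃)
    (π : Equiv.Perm (Fin 4) × Equiv.Perm (Fin 5)) :
    2 * (T.filter fun x => v x ∈ phiOD π).card = T.card := by
  classical
  exact balancedOD_of_signed v (signedOD_of_defectOD
    (d₂ := fun a => ((T.filter fun x => v x = Sum.inr (Sum.inl (a, true))).card : ℤ) -
      (T.filter fun x => v x = Sum.inr (Sum.inl (a, false))).card)
    (d₃ := fun b => ((T.filter fun x => v x = Sum.inr (Sum.inr (b, true))).card : ℤ) -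
      (T.filter fun x => v x = Sum.inr (Sum.inr (b, false))).card) h₁ h₃ he π)

/-- **Balanced under a rotation-stable, octic-transitive `R` ⟹ balanced under every set of pairs** (the defect law does not see `R`).
[folklore] -/
theorem ModelBalancedOD.of_rot (g : Equiv.Perm (Fin 5)) (hrot : ∀ π ∈ R, (π.1, π.2 * (g * finRotate 5 * g⁻¹)) ∈ R)
    (ht : ∀ x : Fin 4, ∃ π ∈ R, π.1 x = 0) {T : Finset α} (hT : ModelBalancedOD R v T)
    (R' : Finset (Equiv.Perm (Fin 4) × Equiv.Perm (Fin 5))) : ModelBalancedOD R' v T := by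
  obtain ⟨t₂, t₃, h₁, h₃, he⟩ := exists_defectOD_of_modelBalancedOD g hrot ht hT
  exact fun π _ => balancedOD_of_defect h₁ h₃ he π

end Config

end Summit.HodgeConjecture.CorCM.Census.OcticDecicWeil
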